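import Mathlib
import HarnessLib.Audit
import Summits.PneNP.PneNP.Theorems.PstarCrossCaseU2Clean
import Summits.PneNP.PneNP.Theorems.PstarRankRigidityTwo

/-!
# The blind free CROSS gate: a PRODUCT row reads only the private tree edges inside the supports of its two affine factors (O2 / E1; prover-1 g22)

FRONTIER range-avoidance ladder, rung F-N3 (`stmt-PneNP-19007`), cell `pnp-ideate`; restricted-model proof complexity — nothing here bears on `P` versus `NP`.

The residual rows of the nodes (`PstarCrossCaseU2.qDir10_cases` / `qDir01_cases`, and `PstarRankRigidityFour.classification` applied in N1–N3) have the shape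
`q_{mv} + κ = μ₁ · μ₂` or `u_{e₀} + (q_{mv} + κ) = μ₁ · μ₂` with `μ₁, μ₂` affine.  For such a row the constraint `(C, G, T)` behind `q_{mv}` reads an AND
variable `v` of a PRIVATE tree edge `π` only if `v` lies in the support of a linear part: **`untouched_of_product_row`** — if `μ_i(e_v) = μ_i(0)` for `i = 1, 2`
and both AND variables `v` of `π`, then `C` contains neither AND variable of `π` and no monomial of `G` contains one (the polar form of a product of affine
functions is `ℓ₁ ⊗ ℓ₂ + ℓ₂ ⊗ ℓ₁`, `PstarRankRigidityTwo.affine_mul_polar`; the `u_{e₀}`-part pairs only the two mates,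
`PstarCrossCasePEmptyToggle.andAdj_priv_iff`).  So in a product row the touched private edges carry a variable of `supp ℓ₁ ∪ supp ℓ₂`, where the cross
monomials `x_v x_b` (`b` in the other support) are CARRIERS — the input of `PstarCrossBudgetCarriers.cross_budget_carriers`.
-/

set_option linter.dupNamespace false -- `Summit.PneNP.PneNP.…`: summit = sub-problem name (D-0017 single-conjunct layout)

open Finset Module Literature.Computability.Complexity
open Summit.PneNP.PneNP.Theorems.PstarTyped (Typed)
open Summit.PneNP.PneNP.Theorems.PstarSALevel (varSet BoundaryExpanding SimpleOverlap)
open Summit.PneNP.PneNP.Theorems.PstarCentreFree (vars_mem_varSet)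
open Summit.PneNP.PneNP.Theorems.PstarCubeIdeals (IsAffineFn)
open Summit.PneNP.PneNP.Theorems.PstarProductRank (qform polar)
open Summit.PneNP.PneNP.Theorems.PstarPathRank (AndAdj polar_basis)
open Summit.PneNP.PneNP.Theorems.PstarReadSumset (V2)
open Summit.PneNP.PneNP.Theorems.PstarRankRigidityTwo (affine_mul_polar symForm_apply linPart_apply)
open Summit.PneNP.PneNP.Theorems.PstarChordSystem (ChordSystem)
open Summit.PneNP.PneNP.Theorems.PstarChordBridgeTools
open Summit.PneNP.PneNP.Theorems.PstarChordBridge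
open Summit.PneNP.PneNP.Theorems.PstarChordBridgeForcing (freeMon gam sys_u_eq)
open Summit.PneNP.PneNP.Theorems.PstarChordBridgeBasis (qDir polarDir)
open Summit.PneNP.PneNP.Theorems.PstarChordBridgeCorner (qDir_add)
open Summit.PneNP.PneNP.Theorems.PstarGateCasePUnitsTouch (not_mem_C_of_qDir polarDir_single)
open Summit.PneNP.PneNP.Theorems.PstarCrossData (CrossData)
open Summit.PneNP.PneNP.Theorems.PstarCrossSystem
open Summit.PneNP.PneNP.Theorems.PstarCrossCorner (PrivEdge)
open Summit.PneNP.PneNP.Theorems.PstarCrossCornerReads (avoid_of_polar_zero_off_mate)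
open Summit.PneNP.PneNP.Theorems.PstarCrossCasePEmptyToggle (andAdj_priv_iff)
open Summit.PneNP.PneNP.Theorems.PstarCrossCaseU2 (u_add)

namespace Summit.PneNP.PneNP.Theorems.PstarCrossProductRow

variable {n m : ℕ}

section

variable (I : LocalMap 4 n m) {r : ℕ} {B : BridgeData n m} {e_p e_q g₀ : Fin m}

/-- **A product row reads no private tree edge off the supports of its factors.**  `(C, G, T)` is the constraint behind `q_{mv}` (`mv = (1,0)`: the second;
`(0,1)`: the first); the row is `q_{mv} + κ = μ₁ μ₂` or `u_{e₀} + (q_{mv} + κ) = μ₁ μ₂` for a real chord `e₀`; `π` is a private tree edge whose AND variables are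
off both supports (`μ_i(e_v) = μ_i(0)`). -/
theorem untouched_of_product_row (hI : I.IsPure xorAndPred) (hS : SimpleOverlap I) (hD : CrossData I r B e_p e_q g₀) {e₀ : Fin m} (he₀ : e₀ ∈ B.N)
    {mv : V2} {C : Finset (Fin n)} {G T : Finset (Fin m)} (hTJ : T ⊆ B.J₀ \ B.N) (hGJ : Disjoint G B.J₀)
    (hGfree : ∀ g ∈ G, ¬ (I.vars g 2 ∈ privs I B.N ∨ I.vars g 3 ∈ privs I B.N))
    (hlin : ∀ (π : Fin m) (s : Fin 4), π ∈ B.J₀ \ B.N → 2 ≤ s.val → qDir I B mv (Pi.single (I.vars π s) 1) = qDir I B mv 0 → I.vars π s ∉ C)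
    (hpol : ∀ c d : Fin n, polarDir I B mv (Pi.single c 1) (Pi.single d 1) =
      ((polar T (fun j => I.vars j 2) (fun j => I.vars j 3) + polar (freeMon I B.N G) (fun j => I.vars j 2) (fun j => I.vars j 3) :
        LinearMap.BilinForm (ZMod 2) (Fin n → ZMod 2)) (Pi.single c 1)) (Pi.single d 1))
    {κ : ZMod 2} {μ₁ μ₂ : (Fin n → ZMod 2) → ZMod 2} (hμ₁ : IsAffineFn μ₁) (hμ₂ : IsAffineFn μ₂)
    (hrow : (∀ x, qDir I B mv x + κ = μ₁ x * μ₂ x) ∨ (∀ x, (sys I B).u e₀ x + (qDir I B mv x + κ) = μ₁ x * μ₂ x))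
    {π : Fin m} (hπ : PrivEdge I B π)
    (hoff : ∀ s : Fin 4, (s = 2 ∨ s = 3) → μ₁ (Pi.single (I.vars π s) 1) = μ₁ 0 ∧ μ₂ (Pi.single (I.vars π s) 1) = μ₂ 0) :
    (I.vars π 2 ∉ C ∧ I.vars π 3 ∉ C) ∧ ∀ g ∈ G, I.vars g 2 ≠ I.vars π 2 ∧ I.vars g 3 ≠ I.vars π 2 ∧ I.vars g 2 ≠ I.vars π 3 ∧ I.vars g 3 ≠ I.vars π 3 := by
  classical
  have hDJ : B.D e₀ ⊆ B.J₀ := (hD.wf.hD e₀ he₀).trans sdiff_subset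
  have hu0 : ∀ s : Fin 4, (s = 2 ∨ s = 3) → (sys I B).u e₀ (Pi.single (I.vars π s) 1) = (sys I B).u e₀ 0 := fun s _ => by
    rw [sys_u_eq, sys_u_eq, PstarChordBridgeFlat.qform_single I hI, PstarChordBridgeFlat.qform_zero]
  -- no linear term at the AND variables of `π`
  have hlin' : ∀ s : Fin 4, (s = 2 ∨ s = 3) → qDir I B mv (Pi.single (I.vars π s) 1) = qDir I B mv 0 := by
    intro s hs
    obtain ⟨h1, h2⟩ := hoff s hs
    rcases hrow with h | h
    · have a := h (Pi.single (I.vars π s) 1)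
      have b := h 0
      rw [h1, h2] at a
      have e : ∀ q q0 k p : ZMod 2, q + k = p → q0 + k = p → q = q0 := by decide
      exact e _ _ _ _ a b
    · have a := h (Pi.single (I.vars π s) 1)
      have b := h 0
      rw [h1, h2, hu0 s hs] at a
      have e : ∀ u q q0 k p : ZMod 2, u + (q + k) = p → u + (q0 + k) = p → q = q0 := by decide
      exact e _ _ _ _ _ a b
  -- the polar form of `q_{mv}`: `ℓ₁ ⊗ ℓ₂ + ℓ₂ ⊗ ℓ₁` (+ the adjacency of `D e₀` in the second row)
  have hpolar : ∀ x y,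
      polarDir I B mv x y = (μ₁ x + μ₁ 0) * (μ₂ y + μ₂ 0) + (μ₁ y + μ₁ 0) * (μ₂ x + μ₂ 0) ∨
      polarDir I B mv x y = (μ₁ x + μ₁ 0) * (μ₂ y + μ₂ 0) + (μ₁ y + μ₁ 0) * (μ₂ x + μ₂ 0) +
        polar (B.D e₀) (fun j => I.vars j 2) (fun j => I.vars j 3) x y := by
    intro x y
    have e := qDir_add I B mv x y
    have hm := affine_mul_polar hμ₁ hμ₂ x y
    rw [symForm_apply, linPart_apply, linPart_apply, linPart_apply, linPart_apply] at hm
    rcases hrow with h | h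
    · left
      have hx : ∀ z, qDir I B mv z = μ₁ z * μ₂ z + κ := fun z => by
        have e1 : ∀ a k p : ZMod 2, a + k = p → a = p + k := by decide
        exact e1 _ _ _ (h z)
      rw [hx, hx, hx, hx, hm] at e
      have e2 : ∀ a b c s k d : ZMod 2, a + b + c + s + k = a + k + (b + k) + (c + k) + d → d = s := by decide
      exact e2 _ _ _ _ _ _ e
    · right
      have hx : ∀ z, qDir I B mv z = (sys I B).u e₀ z + μ₁ z * μ₂ z + κ := fun z => by
        have e1 : ∀ u a k p : ZMod 2, u + (a + k) = p → a = u + p + k := by decide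
        exact e1 _ _ _ _ (h z)
      rw [hx, hx, hx, hx, hm, u_add I B e₀ x y] at e
      have e2 : ∀ ux uy u0 P a b c s k d : ZMod 2,
          ux + uy + u0 + P + (a + b + c + s) + k = ux + a + k + (uy + b + k) + (u0 + c + k) + d → d = s + P := by decide
      exact e2 _ _ _ _ _ _ _ _ _ _ e
  have hadj : ∀ s s' : Fin 4, (s = 2 ∨ s = 3) → (s' = 2 ∨ s' = 3) → s ≠ s' → ∀ w, w ≠ I.vars π 2 → w ≠ I.vars π 3 →
      polar (K := ZMod 2) (B.D e₀) (fun j => I.vars j 2) (fun j => I.vars j 3) (Pi.single w 1) (Pi.single (I.vars π s) 1) = 0 := by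
    intro s s' hs hs' hss' w hw2 hw3
    rw [polar_basis I hI hS, if_neg]
    intro hA
    have hws' := ((andAdj_priv_iff I hI hDJ hπ hs hs' hss' w).1 hA).2
    rcases hs' with rfl | rfl
    · exact hw2 hws'
    · exact hw3 hws'
  have hoffpol : ∀ s s' : Fin 4, (s = 2 ∨ s = 3) → (s' = 2 ∨ s' = 3) → s ≠ s' → ∀ w, w ≠ I.vars π 2 → w ≠ I.vars π 3 →
      ((polar T (fun j => I.vars j 2) (fun j => I.vars j 3) + polar (freeMon I B.N G) (fun j => I.vars j 2) (fun j => I.vars j 3) :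
        LinearMap.BilinForm (ZMod 2) (Fin n → ZMod 2)) (Pi.single w 1)) (Pi.single (I.vars π s) 1) = 0 := by
    intro s s' hs hs' hss' w hw2 hw3
    obtain ⟨h1, h2⟩ := hoff s hs
    rw [← hpol]
    rcases hpolar (Pi.single w 1) (Pi.single (I.vars π s) 1) with h | h
    · rw [h, h1, h2, CharTwo.add_self_eq_zero, CharTwo.add_self_eq_zero, mul_zero, zero_mul, zero_add]
    · rw [h, h1, h2, CharTwo.add_self_eq_zero, CharTwo.add_self_eq_zero, mul_zero, zero_mul, zero_add, zero_add,
        hadj s s' hs hs' hss' w hw2 hw3]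
  refine ⟨⟨hlin π 2 hπ.1 (by decide) (hlin' 2 (Or.inl rfl)), hlin π 3 hπ.1 (by decide) (hlin' 3 (Or.inr rfl))⟩, fun g hg => ?_⟩
  have hgf : g ∈ freeMon I B.N G := mem_filter.2 ⟨hg, hGfree g hg⟩
  have h2 := avoid_of_polar_zero_off_mate I hI hS (hTJ.trans sdiff_subset) hGJ hπ (Or.inl rfl)
    (hoffpol 2 3 (Or.inl rfl) (Or.inr rfl) (by decide)) g hgf
  have h3 := avoid_of_polar_zero_off_mate I hI hS (hTJ.trans sdiff_subset) hGJ hπ (Or.inr rfl)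
    (hoffpol 3 2 (Or.inr rfl) (Or.inl rfl) (by decide)) g hgf
  exact ⟨h2.1, h2.2, h3.1, h3.2⟩

end

end Summit.PneNP.PneNP.Theorems.PstarCrossProductRow
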